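/-
Copyright: the b2b-balaban cell (near-miss cell 7), T⁴-continuum fan-out, lineage t4-ne7b-p3 (node U5c LARGE-DEVIATION
member P3).  Released under the licence of the surrounding project.
-/
import Summits.QuantumFields.BalabanUV.T4Continuum.Support.SpaceTimePinning

/-!
# Space-time Peierls ∕ Cramér route for NE7b — leaf A3 split, CORRECTION: the remainder may depend on the pinned contour
# (skeleton row ST9, v1.1 of the split as a separate module)

Summits-side support leaf of the T⁴-continuum cell (rung (B)+1 on a FINITE torus only; NOT infinite volume, NOT the
mass gap, NOT the Clay statement; NOT a proof of the spine estimate NE7b).  Lineage `t4-ne7b-p3` (generation 2), node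
U5c, skeleton `t4/skeletons/NE7b-t4-ne7b-p3.md` leaf A3 (sub-leaves A3a–A3f), row ST9.  [folklore] real arithmetic over
the abstract carrier `SpaceTimePeierlsLeaves.OccModel` and the v1 split `SpaceTimePinning` (this lineage); nothing is
quoted from print and nothing printed is asserted; no `[cite:]` tag.  (Filed as a separate module because the
append-only revision of `SpaceTimePinning` carrying the same declarations, p209080, has not been decided; if that
revision lands first this module is redundant and bounces on the duplicate names.)

WHAT.  A term with SEVERAL final live components has several contours, and the remainder weight obtained by stripping
the PINNED lineage's banked factor depends on WHICH contour is pinned (the other lineages keep their factors: they pay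
for their own placement inside the resummed remainder).  `SpaceTimePinning.PinnedSplit` asked for one remainder
`rest τ` serving every contour of `τ` at once, which only single-lineage models inhabit honestly.  `PinnedSplitK` lets
the remainder depend on the contour; the product argument is unchanged; `PinnedSplit` is the special case of a
constant family (`PinnedSplit.toK`); `factor_of_surplusK` is the factor half from a per-contour surplus.

HONEST DEPENDENCY (cell, verbatim): continuum YM on T⁴ ⇐ BetaPertH ∧ nine spine estimates (0/9 proved); BetaPertH ⇐
(D1) ∧ (D4) ∧ CAP+tail; G-an2-4 gates asym, D1 and NE2/3/4.  This file changes none of it.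
-/

open Finset

namespace Summit.QuantumFields.BalabanUV.T4Continuum.SpaceTimePeierlsLeaves

variable {ι Cell : Type*}

open Classical in
/-- NAMED SHAPE `PinnedSplitK M A rest q₀ m nup` (ONE run, ONE `(K, t)`; v1.1, contour-dependent remainder): for every
cell set `𝒦` — (FACTOR) each term having `𝒦` as a contour weighs at most `q₀^{#𝒦} · rest 𝒦 τ` with `rest 𝒦 τ ≥ 0`
(the banked factor of the lineage whose contour is `𝒦` pulled out: A3a ∧ A3b ∧ A3d); (REMAINDER)
`Σ_{τ pinned by 𝒦} rest 𝒦 τ ≤ m^{#𝒦} · nup` (A3f multiplicity × A3e envelope).  A hypothesis shape; nothing asserted.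
[folklore] -/
structure OccModel.PinnedSplitK (M : OccModel ι Cell) (A : ι → ℝ) (rest : Finset Cell → ι → ℝ) (q₀ m nup : ℝ) :
    Prop where
  /-- the remainder weights are nonnegative -/
  rest_nonneg : ∀ (𝒦 : Finset Cell), ∀ τ ∈ M.T, 0 ≤ rest 𝒦 τ
  /-- FACTOR half: the pinned lineage's factor is at most `q₀^{#𝒦}` -/
  factor : ∀ (𝒦 : Finset Cell), ∀ τ ∈ M.T, M.IsContour τ 𝒦 → A τ ≤ q₀ ^ 𝒦.card * rest 𝒦 τ
  /-- REMAINDER half: multiplicity × envelope -/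
  remainder : ∀ (𝒦 : Finset Cell), ∑ τ ∈ M.T.filter (fun τ => M.IsContour τ 𝒦), rest 𝒦 τ ≤ m ^ 𝒦.card * nup

open Classical in
/-- **A3 FROM ITS HALVES, contour-dependent remainder**: `PinnedSplitK M A rest q₀ m nup` with `q₀ ≥ 0` gives
`PinnedContourBound M A (q₀·m) nup`. [folklore] -/
theorem OccModel.pinnedContourBound_of_splitK {M : OccModel ι Cell} {A : ι → ℝ} {rest : Finset Cell → ι → ℝ}
    {q₀ m nup : ℝ} (h : M.PinnedSplitK A rest q₀ m nup) (hq₀ : 0 ≤ q₀) : M.PinnedContourBound A (q₀ * m) nup := by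
  intro 𝒦
  calc ∑ τ ∈ M.T.filter (fun τ => M.IsContour τ 𝒦), A τ
      ≤ ∑ τ ∈ M.T.filter (fun τ => M.IsContour τ 𝒦), q₀ ^ 𝒦.card * rest 𝒦 τ :=
        sum_le_sum fun τ hτ => h.factor 𝒦 τ (mem_filter.1 hτ).1 (mem_filter.1 hτ).2
    _ = q₀ ^ 𝒦.card * ∑ τ ∈ M.T.filter (fun τ => M.IsContour τ 𝒦), rest 𝒦 τ := by rw [mul_sum]
    _ ≤ q₀ ^ 𝒦.card * (m ^ 𝒦.card * nup) := mul_le_mul_of_nonneg_left (h.remainder 𝒦) (pow_nonneg hq₀ _)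
    _ = (q₀ * m) ^ 𝒦.card * nup := by rw [mul_pow]; ring

/-- a contour-independent split is a contour-dependent one (v1 ⊆ v1.1) [folklore] -/
theorem OccModel.PinnedSplit.toK {M : OccModel ι Cell} {A rest : ι → ℝ} {q₀ m nup : ℝ}
    (h : M.PinnedSplit A rest q₀ m nup) : M.PinnedSplitK A (fun _ => rest) q₀ m nup where
  rest_nonneg _ := h.rest_nonneg
  factor := h.factor
  remainder := h.remainder

/-- The factor half from a PER-TERM, PER-CONTOUR SURPLUS (v1.1): if each term pinned by `𝒦` weighs at most
`e^{−S 𝒦 τ} · rest 𝒦 τ` with a surplus `S 𝒦 τ ≥ s · #𝒦` (the banked rate of the lineage whose contour is `𝒦`: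
`SpaceTimeBankedRate.surplus_ge_rateB_printedShape` with `vol = #𝒦`), then the factor binder holds with `q₀ = e^{−s}`.
[folklore] -/
theorem factor_of_surplusK {M : OccModel ι Cell} {A : ι → ℝ} {rest S : Finset Cell → ι → ℝ} {s : ℝ}
    (hrest : ∀ (𝒦 : Finset Cell), ∀ τ ∈ M.T, 0 ≤ rest 𝒦 τ)
    (hA : ∀ (𝒦 : Finset Cell), ∀ τ ∈ M.T, M.IsContour τ 𝒦 → A τ ≤ Real.exp (-S 𝒦 τ) * rest 𝒦 τ)
    (hS : ∀ (𝒦 : Finset Cell), ∀ τ ∈ M.T, M.IsContour τ 𝒦 → s * 𝒦.card ≤ S 𝒦 τ) :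
    ∀ (𝒦 : Finset Cell), ∀ τ ∈ M.T, M.IsContour τ 𝒦 → A τ ≤ Real.exp (-s) ^ 𝒦.card * rest 𝒦 τ := by
  intro 𝒦 τ hτ hc
  refine (hA 𝒦 τ hτ hc).trans (mul_le_mul_of_nonneg_right ?_ (hrest 𝒦 τ hτ))
  rw [← Real.exp_nat_mul, Real.exp_le_exp]
  have := hS 𝒦 τ hτ hc
  linarith

end Summit.QuantumFields.BalabanUV.T4Continuum.SpaceTimePeierlsLeaves
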